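import Mathlib
import Literature.NumberTheory.Transcendental.BeukersZetaThreeIntegralsProofs
import HarnessLib

/-!
# Rhin–Viola 2001: the eight-parameter family `I(h,j,k,l,m,q,r,s)`, its arithmetic, and the permutation group

Topic `Literature/NumberTheory/Irrationality/RhinViola2001`. Typed, cited statements (named facts, no proof;
D-0014) with DEFINITIONS and PROVED structural companions, read on the page (this session) from G. Rhin,
C. Viola, *The group structure for ζ(3)*, Acta Arith. **97** (2001) 269–293 [RhinViola2001], Sections 2–5.
The sibling file `ZetaThreeMeasure.lean` holds only the headline (1.4) `μ(ζ(3)) < 5.513891`; the hypergeometric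
(Bailey `₇F₆`) side of the same group is `Zudilin2004/GroupStructureZeta3.lean` (Zudilin 2004, Lemmas 7–9), whose
docstring lists "Not typed here: Lemma 9 itself (`H(c)/Π(c)` with `H(c)` the Rhin–Viola integral) … the arithmetic
of Sect. 5" — this file supplies the INTEGRAL side: Rhin–Viola's own triple integrals and their arithmetic.

HONEST FRAMING (cells pub-zeta5 / zeta5-irr): systematic search; no irrationality claim unless certified. Nothing
here concerns `ζ(5)`; these are the printed `ζ(3)` statements whose `ζ(5)` analogues (Brown–Zudilin 2022, (28)–(30))
the cell studies.

## What is printed (page numbers of Acta Arith. 97)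

* §2 (p. 271): for integers `h, j, k, l, q, r, s` the integral
  `I(h,j,k,l,m,q,r,s) = ∫₀¹∫₀¹∫₀¹ x^h(1−x)^l y^k(1−y)^s z^j(1−z)^q / (1−(1−xy)z)^{q+h−r} · dx dy dz/(1−(1−xy)z)`   (2.1)
  ("In the special case `h = j = k = l = q = r = s` [it] was introduced by Beukers"), finite iff all of
  `h, j, k, l, q, r, s ≥ 0` and `h ≤ k + r`; `m := k + r − h`, so that
  `h + m = k + r`   (2.2),  and the further assumption  `j + q = l + s`   (2.3).
* (2.8) (p. 273): the eight auxiliary integers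
  `h' = h+l−j, j' = j+m−k, k' = k+q−l, l' = l+r−m, m' = m+s−q, q' = q+h−r, r' = r+j−s, s' = s+k−h`
  (the primed names are (4.7), p. 285), permuted by `ϑ` and `σ`.
* **Theorem 2.1** (pp. 273–274). "Let `h, j, k, l, m, q, r, s` be non-negative integers satisfying `h + m = k + r`
  and `j + q = l + s`. Let `S` denote the sequence of the integers (2.8) … and let `M = max S`, `N = max′ S`,
  `Q = max″ S` [the three successive maxima, p. 273]. Then the integral `I = I(h,j,k,l,m,q,r,s)` satisfies
  `I = a + 2bζ(3)`, with `d_M d_N d_Q a ∈ ℤ` and `b ∈ ℤ`" (2.9), where `d_0 = 1`, `d_n = lcm{1,…,n}`.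
  Proof = the finite DESCENT (2.10) `I = I(h,j,k,l−1,m−1,q−1,r−1,s) − I(h+1,j,k,l−1,m−1,q−1,r,s) − I(h,j+1,k,l,m−1,q−1,r−1,s)`
  from `(1−x)(1−z) = 1−x−(1−x)z`, the permutations `ϑ, σ`, and the base case (2.11)
  `I(h,0,h,0,h,0,h,0) = ∫∫ −log(xy)/(1−xy) x^h y^h = −2Σ_{ν=1}^{h} ν^{−3} + 2ζ(3)` "by Lemma 1 of [Beukers]".
  Remark 2.1: `M ≥ N ≥ Q ≥ 0`. Remark 2.2: for `j + q < l + s` still `I ∈ ℚ + 2ℤζ(3)`.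
* (p. 272): the birational map `ϑ` (period 8, maps `(0,1)³` onto itself, (2.4)–(2.6)) acts by the cyclic
  permutation `ϑ = (h j k l m q r s)`: `I(h,j,k,l,m,q,r,s) = I(j,k,l,m,q,r,s,h)`; the swap `σ : x ↔ y` acts by
  `σ = (h k)(l s)(m r)`: `I(h,j,k,l,m,q,r,s) = I(k,j,h,s,r,q,m,l)`; "`Θ = ⟨ϑ, σ⟩` is isomorphic to the dihedral
  group `D_8` of order 16, and the value of `I(h,j,k,l,m,q,r,s)` is invariant under the action of the group `Θ`."
* §3 **Lemma 3.1 / Theorem 3.1** (pp. 276–279): with `C = {|x| = ρ₁}`, `C_x = {|y − 1/x| = ρ₂}`,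
  `C_{x,y} = {|z − (1−xy)^{−1}| = ρ₃}` (any `ρ₁, ρ₂, ρ₃ > 0`), the contour integral
  `Ĩ = (2πi)^{−3} ∫_C∫_{C_x}∫_{C_{x,y}}` of the same integrand is invariant under `Θ` and "the integer `b` in
  (2.9) is given by `b = Ĩ`".
* §4 (pp. 279–287): the hypergeometric integral transformations
  `I(h,j,k,l,m,q,r,s) = h! l!/((q+h−r)! (r+l−q)!) · I(q+h−r, j, k, r+l−q, m, r, q, s)`   (4.1)
  and (in `z`) `I(h,j,k,l,m,q,r,s) = j! q!/((q+h−r)! (j+r−h)!) · I(h, q+h−r, k, l, m, j+r−h, r, s)`, valid when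
  the integers (2.7) and (2.8) are all non-negative (standing assumption of §4, p. 280); the associated
  permutations of the sixteen integers `ϕ = (h q')(l r')(q r)(m' s')`, `χ = (j q')(q j')(h' r')(k' m')`;
  `Φ = ⟨ϕ, χ, ϑ, σ⟩ = ⟨ϕ, ϑ⟩`, `|Φ| = 1920`, `Φ ↪ A₁₀` via the ten sums (4.2), `1 → (ℤ/2)⁴ → Φ → S₅ → 1`;
  the transformation formula (4.4): `I(h,…,s)/(h!j!k!l!m!q!r!s!)` is `Φ`-invariant; 120 left cosets of `Θ`
  classified by level (1, 12, 32, 30, 32, 12, 1 of levels 0, 2, 3, 4, 5, 6, 8), e.g. the level-4 formula (5.4)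
  `I(h,j,k,l,m,q,r,s) = h!k!l!r!/(m'!r'!h'!q'!) · I(m', r', m, h', q, q', s, j)` for `ϕϑ²ϕ`.
* §5 (pp. 287–293): with `I_n = I(hn,…,sn) = a_n + 2b_nζ(3)`, `M, N, Q` the successive maxima of the SIXTEEN
  integers `T = (h,…,s,h',…,s')` (5.3) and `A_n = d_{Mn}d_{Nn}d_{Qn}a_n ∈ ℤ`, a permutation of level 4 and a prime
  `p > √(Mn)` with `ω = {n/p}` give `p | A_n` when `[m'ω]+[r'ω]+[h'ω]+[q'ω] < [hω]+[kω]+[lω]+[rω]` (5.12) and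
  `p² | A_n` under (5.13); Lemma 5.1; (5.14) `lim (1/n) log D_n = M+N+Q − (∫_{Ω_E}dψ + ∫_{Ω'_E}dψ)`;
  **Theorem 5.1** "If `c₀ > c₂`, then `μ(ζ(3)) ≤ (c₀+c₁)/(c₀−c₂)`"; the choice
  `(h,j,k,l,m,q,r,s) = (16,17,19,15,12,11,9,13)`, `(h',…,s') = (14,10,15,12,14,18,13,16)`, `M,N,Q = 19,18,17`,
  `c₀ = 47.15472079…`, `c₁ = 48.46940964…`, `c₂ = 29.81231469…` ⇒ `μ(ζ(3)) < 5.513891` (`ZetaThreeMeasure.lean`).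

## What is typed here

DEFINITIONS: `Params` (the eight integers), `Params.aux` (the eight integers (2.8) = (4.7), again a `Params`
in the order `h',j',…,s'`), `Params.Balanced` ((2.2)–(2.3)), `Params.Nonneg`, `Params.Admissible` (§4: (2.7) and
(2.8) non-negative), `integrand`/`I` (the triple integral (2.1) as a Lebesgue set integral over the open unit
cube, the shape of `Transcendental.Beukers.tripleIntegral`), `succMax` (successive maxima), `denomS`
(`d_M d_N d_Q` of Theorem 2.1), `maxT` ((5.3)), `theta`/`sigma`/`phi`/`chi` (the generators as maps on
parameters), `Gen`/`act` (words in the generators), `factProd`/`normI` ((4.3)), `contourIntegrand`/`contourI`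
((3.1)), `Params.scale` (`I_n`), `rvChoice` (§5).
NAMED FACTS (cited): `theorem21` [Thm 2.1], `invariance_theta` [p. 272], `theorem31`
[Lemma 3.1 + Thm 3.1] (statement only), and `hypergeometric_x` [(4.1)], `hypergeometric_z` [(4.1) in `z`, p. 281]
— these two PROVED in the companion `GroupStructureProofs.lean` (`hypergeometric_x_holds`, `hypergeometric_z_holds`:
Euler's integral for `₂F₁` and its symmetry in the numerator parameters, Tonelli on the cube).
PROVED (no analysis beyond a measure-preserving coordinate swap): `invariance_sigma` (`σ`-invariance of `I`),
the generators preserve (2.2)–(2.3) and admissibility and permute the sixteen integers (`aux_theta`,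
`aux_sigma`, `aux_phi`, `aux_chi`, `T_perm_*`, hence `maxT_*`: the maxima (5.3) are `Φ`-invariant),
`ϑ⁸ = σ² = ϕ² = χ² = id`, the level-4 representative (5.4) `ϕϑ²ϕ(P) = (m',r',m,h',q,q',s,j)`
(`phi_theta_theta_phi`), the level-8 element `η` (`eta_apply`), the transformation formula (4.4) for every
word in the generators from the generator statements (`normI_act`), the identification with Beukers' integral
`I(n,…,n) = Beukers.tripleIntegral n` (`I_diag`) and `I(0,…,0) = 2ζ(3)` (`I_zero`, from the tree's
`Beukers.tripleIntegral_zero_holds`), and the printed numerical data of §5 for `(16,17,19,15,12,11,9,13)`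
(`rvChoice_aux`, `rvChoice_maxT`, `record_quotient_lt`).
NOT typed: `|Φ| = 1920` and the `A₁₀`/`S₅` structure (a finite group computation), the coset census,
Remark 2.2, the sets `Ω_E, Ω'_E`, Lemma 5.1 and Theorem 5.1 in its `(c₀, c₁, c₂)` form (the headline it yields
is `ZetaThreeMeasure.lean`). `ζ(3) = zetaValue 3` of `PeriodsWave0.lean`.
-/

noncomputable section

open MeasureTheory Set

namespace Literature.NumberTheory.Irrationality.RhinViola2001

open Literature.NumberTheory.Transcendental (zetaValue)
open Literature.NumberTheory.Transcendental.Beukers (tripleIntegral tripleIntegral_zero_holds)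

/-! ### §2: the parameters, the auxiliary integers (2.8), and the integral (2.1) -/

/-- The eight integer parameters `h, j, k, l, m, q, r, s` (the source fixes `m = k + r − h`; here `m` is a coordinate
and (2.2) is the hypothesis `Balanced`). [cite: RhinViola2001, §2 (2.7)] -/
@[ext] structure Params where
  h : ℤ
  j : ℤ
  k : ℤ
  l : ℤ
  m : ℤ
  q : ℤ
  r : ℤ
  s : ℤ
deriving DecidableEq

namespace Params

/-- The eight auxiliary integers (2.8), in the primed notation (4.7):
`h' = h+l−j, j' = j+m−k, k' = k+q−l, l' = l+r−m, m' = m+s−q, q' = q+h−r, r' = r+j−s, s' = s+k−h`.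
[cite: RhinViola2001, §2 (2.8) and §4 (4.7)] -/
def aux (P : Params) : Params :=
  ⟨P.h + P.l - P.j, P.j + P.m - P.k, P.k + P.q - P.l, P.l + P.r - P.m,
    P.m + P.s - P.q, P.q + P.h - P.r, P.r + P.j - P.s, P.s + P.k - P.h⟩

/-- Conditions (2.2) `h + m = k + r` and (2.3) `j + q = l + s`. [cite: RhinViola2001, §2 (2.2)–(2.3)] -/
def Balanced (P : Params) : Prop := P.h + P.m = P.k + P.r ∧ P.j + P.q = P.l + P.s

/-- All eight parameters are non-negative (hypothesis of Theorem 2.1). [cite: RhinViola2001, Theorem 2.1] -/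
def Nonneg (P : Params) : Prop :=
  0 ≤ P.h ∧ 0 ≤ P.j ∧ 0 ≤ P.k ∧ 0 ≤ P.l ∧ 0 ≤ P.m ∧ 0 ≤ P.q ∧ 0 ≤ P.r ∧ 0 ≤ P.s

/-- The standing assumption of §§4–5: (2.2), (2.3), and the sixteen integers (2.7), (2.8) are non-negative.
[cite: RhinViola2001, §4 p. 280 ("we henceforth assume the non-negative integers (2.7) to be such that (2.8)
are also non-negative")] -/
def Admissible (P : Params) : Prop := P.Balanced ∧ P.Nonneg ∧ P.aux.Nonneg

/-- The parameters as a list `[h, j, k, l, m, q, r, s]` (plumbing). [cite: RhinViola2001, §2 (2.7)] -/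
def toList (P : Params) : List ℤ := [P.h, P.j, P.k, P.l, P.m, P.q, P.r, P.s]

/-- The sequence `S` of the eight integers (2.8). [cite: RhinViola2001, Theorem 2.1] -/
def S (P : Params) : List ℤ := P.aux.toList

/-- The sequence `T = (h, j, k, l, m, q, r, s, h', j', k', l', m', q', r', s')` of §5.
[cite: RhinViola2001, §5 (5.1), (4.7), before (5.3)] -/
def T (P : Params) : List ℤ := P.toList ++ P.aux.toList

/-- `I_n`: all parameters multiplied by `n` ((5.2)). [cite: RhinViola2001, §5 (5.2)] -/
def scale (n : ℤ) (P : Params) : Params :=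
  ⟨n * P.h, n * P.j, n * P.k, n * P.l, n * P.m, n * P.q, n * P.r, n * P.s⟩

end Params

/-- Successive maxima: `succMax L 0 = max L`, `succMax L 1 = max′ L`, `succMax L 2 = max″ L`, the entries
of `L` sorted in decreasing order (with multiplicity); `0` beyond the length.
[cite: RhinViola2001, §2 p. 273 (definition of max, max′, max″)] -/
def succMax (L : List ℤ) (i : ℕ) : ℤ := (L.insertionSort (· ≥ ·)).getD i 0

/-- `d_n = lcm{1, …, n}` for `n ≥ 1`, `d_0 = 1` (and `d_n = 1` for `n < 0`, which never occurs: Remark 2.1),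
Mathlib's `Nat.lcmUpto`. [cite: RhinViola2001, §2 p. 271] -/
def d (n : ℤ) : ℕ := Nat.lcmUpto n.toNat

/-- `d_M d_N d_Q` with `M, N, Q` the three successive maxima of `S` = (2.8) (Theorem 2.1).
[cite: RhinViola2001, Theorem 2.1] -/
def denomS (P : Params) : ℕ := d (succMax P.S 0) * d (succMax P.S 1) * d (succMax P.S 2)

/-- `M, N, Q` of §5 (5.3): the three successive maxima of the sixteen integers `T`.
[cite: RhinViola2001, §5 (5.3)] -/
def maxT (P : Params) (i : ℕ) : ℤ := succMax P.T i

/-- The open unit cube `(0,1)³` (coordinates `p 0 = x`, `p 1 = y`, `p 2 = z`), written as for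
`Transcendental.Beukers.tripleIntegral`. [cite: RhinViola2001, §2 (2.1), (2.4)] -/
def cube : Set (Fin 3 → ℝ) := {p | ∀ i, p i ∈ Ioo (0 : ℝ) 1}

/-- The integrand of (2.1): `x^h(1−x)^l y^k(1−y)^s z^j(1−z)^q / (1−(1−xy)z)^{q+h−r+1}` (integer exponents;
for `q + h − r < 0` "I is the integral of a polynomial", proof of Theorem 2.1).
[cite: RhinViola2001, §2 (2.1)] -/
def integrand (P : Params) (p : Fin 3 → ℝ) : ℝ :=
  p 0 ^ P.h * (1 - p 0) ^ P.l * p 1 ^ P.k * (1 - p 1) ^ P.s * p 2 ^ P.j * (1 - p 2) ^ P.q /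
    (1 - (1 - p 0 * p 1) * p 2) ^ (P.q + P.h - P.r + 1)

/-- **`I(h,j,k,l,m,q,r,s)`**, the triple integral (2.1) over the open unit cube (Lebesgue set integral; the
parameter `m` does not occur in the integrand and is tied to the others by (2.2)).
[cite: RhinViola2001, §2 (2.1), p. 272 (notation `I(h,j,k,l,m,q,r,s)`)] -/
def I (P : Params) : ℝ := ∫ p in cube, integrand P p

/-- **Theorem 2.1** (Rhin–Viola 2001; named fact, statement only). For non-negative integers
`h, j, k, l, m, q, r, s` with `h + m = k + r` and `j + q = l + s`: `I(h,j,k,l,m,q,r,s) = a + 2bζ(3)` with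
`b ∈ ℤ`, `a ∈ ℚ` and `d_M d_N d_Q a ∈ ℤ`, where `M ≥ N ≥ Q` are the three successive maxima of the eight
integers (2.8). [cite: RhinViola2001, Theorem 2.1 (pp. 273–274), proof pp. 274–275] -/
def theorem21 : Prop :=
  ∀ P : Params, P.Nonneg → P.Balanced →
    ∃ (a : ℚ) (b : ℤ), I P = a + 2 * b * zetaValue 3 ∧ ∃ A : ℤ, (denomS P : ℚ) * a = A

/-! ### The dihedral group `Θ = ⟨ϑ, σ⟩` (p. 272) -/

/-- The action of the birational map `ϑ` (2.6) on the parameters: `I(h,j,k,l,m,q,r,s) ↦ I(j,k,l,m,q,r,s,h)`,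
the cyclic permutation `ϑ = (h j k l m q r s)`. [cite: RhinViola2001, §2 p. 272] -/
def theta (P : Params) : Params := ⟨P.j, P.k, P.l, P.m, P.q, P.r, P.s, P.h⟩

/-- The action of `σ : x ↔ y`: `I(h,j,k,l,m,q,r,s) ↦ I(k,j,h,s,r,q,m,l)`, `σ = (h k)(l s)(m r)`.
[cite: RhinViola2001, §2 p. 272] -/
def sigma (P : Params) : Params := ⟨P.k, P.j, P.h, P.s, P.r, P.q, P.m, P.l⟩

/-- **Invariance under `ϑ`** (named fact, statement only): applying the change of variables `ϑ^{−1}` (2.6) to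
(2.1), "by virtue of (2.2), (2.3), (2.4) and (2.5) we obtain the integral `I(j,k,l,m,q,r,s,h)`".
[cite: RhinViola2001, §2 p. 272 ((2.4)–(2.6))] -/
def invariance_theta : Prop := ∀ P : Params, P.Nonneg → P.Balanced → I (theta P) = I P

/-- "`ϑ` has period 8" ((2.4)), on the parameters. [cite: RhinViola2001, §2 (2.4), p. 272] -/
theorem theta_pow_eight (P : Params) :
    theta (theta (theta (theta (theta (theta (theta (theta P))))))) = P := rfl

/-- `σ` is an involution. [cite: RhinViola2001, §2 p. 272] -/
theorem sigma_sigma (P : Params) : sigma (sigma P) = P := rfl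

/-- `ϑ` preserves (2.2)–(2.3): "`ϑ(h + m) = … = ϑ(k + r)`, `ϑ(j + q) = … = ϑ(l + s)`". [cite: RhinViola2001, §2 p. 273] -/
theorem balanced_theta {P : Params} (hP : P.Balanced) : (theta P).Balanced := by
  obtain ⟨h1, h2⟩ := hP
  constructor <;> simp only [theta] <;> omega

/-- `σ` preserves (2.2)–(2.3): "`σ(h + m) = σ(k + r)`, `σ(j + q) = σ(l + s)`". [cite: RhinViola2001, §2 p. 273] -/
theorem balanced_sigma {P : Params} (hP : P.Balanced) : (sigma P).Balanced := by
  obtain ⟨h1, h2⟩ := hP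
  constructor <;> simp only [sigma] <;> omega

/-- `ϑ` preserves non-negativity of the parameters (it permutes them). [cite: RhinViola2001, §2 p. 272] -/
theorem nonneg_theta {P : Params} (hP : P.Nonneg) : (theta P).Nonneg := by
  obtain ⟨_, _, _, _, _, _, _, _⟩ := hP
  simp only [Params.Nonneg, theta]; omega

/-- `σ` preserves non-negativity of the parameters (it permutes them). [cite: RhinViola2001, §2 p. 272] -/
theorem nonneg_sigma {P : Params} (hP : P.Nonneg) : (sigma P).Nonneg := by
  obtain ⟨_, _, _, _, _, _, _, _⟩ := hP
  simp only [Params.Nonneg, sigma]; omega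

/-- "`ϑ` and `σ` permute the integers (2.8)": `ϑ` acts on `(h',…,s')` by the same 8-cycle (literally, no
hypothesis needed). [cite: RhinViola2001, §2 p. 273] -/
theorem aux_theta (P : Params) : (theta P).aux = theta P.aux := by
  ext <;> simp only [Params.aux, theta]

/-- `σ` acts on `(h',…,s')` by `(h' k')(l' s')(m' r')`, using (2.2)–(2.3). [cite: RhinViola2001, §2 p. 273] -/
theorem aux_sigma {P : Params} (hP : P.Balanced) : (sigma P).aux = sigma P.aux := by
  obtain ⟨h1, h2⟩ := hP
  ext <;> simp only [Params.aux, sigma] <;> omega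

/-- The swap `x ↔ y` changes the integrand of `P` into that of `σP` (uses (2.2) for the exponent
`q + k − m = q + h − r`): "if we interchange the variables `x, y` in (2.1), we get `I(k,j,h,s,r,q,m,l)` by (2.2)".
[cite: RhinViola2001, §2 p. 272] -/
theorem integrand_sigma {P : Params} (hP : P.Balanced) (p : Fin 3 → ℝ) :
    integrand (sigma P) p = integrand P (p ∘ Equiv.swap 0 1) := by
  obtain ⟨h1, _⟩ := hP
  have e0 : (Equiv.swap (0 : Fin 3) 1) 0 = 1 := Equiv.swap_apply_left _ _
  have e1 : (Equiv.swap (0 : Fin 3) 1) 1 = 0 := Equiv.swap_apply_right _ _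
  have e2 : (Equiv.swap (0 : Fin 3) 1) 2 = 2 := by decide
  have hexp : P.q + P.k - P.m + 1 = P.q + P.h - P.r + 1 := by omega
  simp only [integrand, sigma, Function.comp, e0, e1, e2, hexp]
  ring_nf

/-- **Invariance under `σ`** (PROVED: the coordinate swap `x ↔ y` preserves Lebesgue measure and the cube).
[cite: RhinViola2001, §2 p. 272] -/
theorem invariance_sigma {P : Params} (hP : P.Balanced) : I (sigma P) = I P := by
  set e := MeasurableEquiv.piCongrLeft (fun _ : Fin 3 => ℝ) (Equiv.swap (0 : Fin 3) 1) with he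
  have hmp : MeasurePreserving e volume volume :=
    volume_measurePreserving_piCongrLeft (fun _ : Fin 3 => ℝ) (Equiv.swap (0 : Fin 3) 1)
  have he_apply : ∀ p : Fin 3 → ℝ, (e p) = p ∘ Equiv.swap (0 : Fin 3) 1 := by
    intro p; funext i
    rw [he, MeasurableEquiv.coe_piCongrLeft, Equiv.piCongrLeft_apply_eq_cast]
    simp only [cast_eq, Equiv.symm_swap, Function.comp]
  have hset : e ⁻¹' cube = cube := by
    ext p
    simp only [Set.mem_preimage, cube, Set.mem_setOf_eq, he_apply, Function.comp]
    constructor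
    · intro h i
      have := h (Equiv.swap (0 : Fin 3) 1 i)
      rwa [Equiv.swap_apply_self] at this
    · intro h i
      exact h _
  calc I (sigma P) = ∫ p in e ⁻¹' cube, integrand P (e p) := by
        rw [hset]; unfold I
        simp only [he_apply, integrand_sigma hP]
    _ = I P := hmp.setIntegral_preimage_emb e.measurableEmbedding _ _


/-! ### The link with Beukers' integral (p. 271) -/

/-- The diagonal parameters `h = j = k = l = m = q = r = s = n` (Beukers' case). [cite: RhinViola2001, §2 p. 271] -/
def diag (n : ℕ) : Params := ⟨n, n, n, n, n, n, n, n⟩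

/-- Beukers' parameters satisfy (2.2)–(2.3). [cite: RhinViola2001, §2 p. 271] -/
theorem balanced_diag (n : ℕ) : (diag n).Balanced := ⟨rfl, rfl⟩

/-- Beukers' parameters are non-negative. [cite: RhinViola2001, §2 p. 271] -/
theorem nonneg_diag (n : ℕ) : (diag n).Nonneg := by
  simp only [Params.Nonneg, diag]; omega

/-- "In the special case where `h = j = k = l = q = r = s`, the integral (2.1) was introduced by Beukers":
`I(n,…,n)` is the tree's `Beukers.tripleIntegral n`. [cite: RhinViola2001, §2 p. 271] -/
theorem I_diag (n : ℕ) : I (diag n) = tripleIntegral n := by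
  have hfun : integrand (diag n) = fun p : Fin 3 → ℝ =>
      (p 0 * (1 - p 0) * p 1 * (1 - p 1) * p 2 * (1 - p 2)) ^ n / (1 - (1 - p 0 * p 1) * p 2) ^ (n + 1) := by
    funext p
    have hexp : ((n : ℤ) + n - n + 1) = ((n + 1 : ℕ) : ℤ) := by push_cast; ring
    simp only [integrand, diag, hexp, zpow_natCast, mul_pow]
  unfold I tripleIntegral cube
  rw [hfun]

/-- `I(0,0,0,0,0,0,0,0) = ∫∫∫ dx dy dz/(1−(1−xy)z) = 2ζ(3)` — the case `h = 0` of (2.11) (PROVED, from the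
tree's `Beukers.tripleIntegral_zero_holds`). [cite: RhinViola2001, §2 (2.11)] -/
theorem I_zero : I (diag 0) = 2 * zetaValue 3 := by
  rw [I_diag]; exact tripleIntegral_zero_holds

/-! ### §3: the triple contour integral and Theorem 3.1 -/

/-- The integrand of (2.1) = (3.1) as a function of three complex variables. [cite: RhinViola2001, §3 (3.1)] -/
def contourIntegrand (P : Params) (x y z : ℂ) : ℂ :=
  x ^ P.h * (1 - x) ^ P.l * y ^ P.k * (1 - y) ^ P.s * z ^ P.j * (1 - z) ^ P.q /
    (1 - (1 - x * y) * z) ^ (P.q + P.h - P.r + 1)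

/-- `Ĩ(h,j,k,l,m,q,r,s) = (2πi)^{−3} ∫_C ∫_{C_x} ∫_{C_{x,y}}` of the integrand, over the circles
`C = {|x| = ρ₁}`, `C_x = {|y − 1/x| = ρ₂}`, `C_{x,y} = {|z − (1−xy)^{−1}| = ρ₃}` (Mathlib's `circleIntegral`,
iterated). [cite: RhinViola2001, §3 (3.1)] -/
def contourI (P : Params) (ρ₁ ρ₂ ρ₃ : ℝ) : ℂ :=
  (1 / (2 * Real.pi * Complex.I) ^ 3) *
    ∮ x in C(0, ρ₁), ∮ y in C(1 / x, ρ₂), ∮ z in C((1 - x * y)⁻¹, ρ₃), contourIntegrand P x y z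

/-- **Lemma 3.1 and Theorem 3.1** (named fact, statement only). For non-negative parameters with (2.2)–(2.3)
and any `ρ₁, ρ₂, ρ₃ > 0`: the contour integral `Ĩ` is an integer `b`, and `I = a + 2bζ(3)` with `a ∈ ℚ`,
`d_M d_N d_Q a ∈ ℤ` as in Theorem 2.1 — "the integer `b` in (2.9) is given by `b = Ĩ`" (so `Ĩ` does not depend
on the radii and is `Θ`-invariant, Lemma 3.1). [cite: RhinViola2001, Lemma 3.1 (p. 276), Theorem 3.1 (p. 278),
(3.10)] -/
def theorem31 : Prop :=
  ∀ P : Params, P.Nonneg → P.Balanced → ∀ ρ₁ ρ₂ ρ₃ : ℝ, 0 < ρ₁ → 0 < ρ₂ → 0 < ρ₃ →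
    ∃ (a : ℚ) (b : ℤ), contourI P ρ₁ ρ₂ ρ₃ = b ∧ I P = a + 2 * b * zetaValue 3 ∧
      ∃ A : ℤ, (denomS P : ℚ) * a = A

/-! ### §4: the hypergeometric transformations and the group `Φ = ⟨ϕ, χ, ϑ, σ⟩` -/

/-- The action of the hypergeometric transformation in `x` on the parameters:
`(h,j,k,l,m,q,r,s) ↦ (q+h−r, j, k, r+l−q, m, r, q, s) = (q', j, k, r', m, r, q, s)` (the source writes
`r+l−q`, `= r'` by (2.3)), i.e. `ϕ = (h q')(l r')(q r)(m' s')`. [cite: RhinViola2001, §4 (4.1), pp. 280–281] -/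
def phi (P : Params) : Params := ⟨P.aux.q, P.j, P.k, P.aux.r, P.m, P.r, P.q, P.s⟩

/-- The action of the hypergeometric transformation in `z`:
`(h,j,k,l,m,q,r,s) ↦ (h, q+h−r, k, l, m, j+r−h, r, s) = (h, q', k, l, m, j', r, s)` (the source writes `j+r−h`,
`= j'` by (2.2)), i.e. `χ = (j q')(q j')(h' r')(k' m')`. [cite: RhinViola2001, §4 p. 281] -/
def chi (P : Params) : Params := ⟨P.h, P.aux.q, P.k, P.l, P.m, P.aux.j, P.r, P.s⟩

/-- `ϕ` is an involution on parameters satisfying (2.2)–(2.3) (a product of transpositions). [cite: RhinViola2001, §4 p. 281] -/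
theorem phi_phi {P : Params} (hP : P.Balanced) : phi (phi P) = P := by
  obtain ⟨h1, h2⟩ := hP
  ext <;> simp only [phi, Params.aux] <;> omega

/-- `χ` is an involution on parameters satisfying (2.2)–(2.3) (a product of transpositions). [cite: RhinViola2001, §4 p. 281] -/
theorem chi_chi {P : Params} (hP : P.Balanced) : chi (chi P) = P := by
  obtain ⟨h1, h2⟩ := hP
  ext <;> simp only [chi, Params.aux] <;> omega

/-- `ϕ` preserves (2.2)–(2.3): "`ϕ(h + m) = … = ϕ(k + r)` and `ϕ(j + q) = … = ϕ(l + s)`". [cite: RhinViola2001, §4 p. 280] -/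
theorem balanced_phi {P : Params} (hP : P.Balanced) : (phi P).Balanced := by
  obtain ⟨h1, h2⟩ := hP
  constructor <;> simp only [phi, Params.aux] <;> omega

/-- `χ` preserves (2.2)–(2.3): "Again we have `χ(h + m) = χ(k + r)` and `χ(j + q) = χ(l + s)`". [cite: RhinViola2001, §4 p. 281] -/
theorem balanced_chi {P : Params} (hP : P.Balanced) : (chi P).Balanced := by
  obtain ⟨h1, h2⟩ := hP
  constructor <;> simp only [chi, Params.aux] <;> omega

/-- `ϕ` permutes the sixteen integers: on `(h',…,s')` it acts as `(h', j', k', l', s', h, l, m')` (uses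
(2.2)–(2.3)). [cite: RhinViola2001, §4 p. 281 (`ϕ = (h q+h−r)(l r+l−q)(q r)(m+s−q s+m−r)`)] -/
theorem aux_phi {P : Params} (hP : P.Balanced) :
    (phi P).aux = ⟨P.aux.h, P.aux.j, P.aux.k, P.aux.l, P.aux.s, P.h, P.l, P.aux.m⟩ := by
  obtain ⟨h1, h2⟩ := hP
  ext <;> simp only [Params.aux, phi] <;> omega

/-- `χ` permutes the sixteen integers: on `(h',…,s')` it acts as `(r', q, m', l', k', j, h', s')`.
[cite: RhinViola2001, §4 p. 281 (`χ = (j q+h−r)(q j+r−h)(h+l−j r+l−q)(k+q−l m+j−l)`)] -/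
theorem aux_chi {P : Params} (hP : P.Balanced) :
    (chi P).aux = ⟨P.aux.r, P.q, P.aux.m, P.aux.l, P.aux.k, P.j, P.aux.h, P.aux.s⟩ := by
  obtain ⟨h1, h2⟩ := hP
  ext <;> simp only [Params.aux, chi] <;> omega

/-! ### The sixteen integers are permuted: `maxT` is `Φ`-invariant -/

/-- Successive maxima depend only on the multiset of entries (plumbing for "`M`, `N` and `Q` are invariant under the
actions of `ϑ` and `σ`"). [cite: RhinViola2001, §2 p. 274] -/
theorem succMax_eq_of_perm {L L' : List ℤ} (hL : L.Perm L') (i : ℕ) : succMax L i = succMax L' i := by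
  unfold succMax
  rw [((List.perm_insertionSort _ L).trans (hL.trans (List.perm_insertionSort _ L').symm)).eq_of_sortedGE
    (List.sortedGE_insertionSort (l := L)) (List.sortedGE_insertionSort (l := L'))]

/-- The sixteen integers as a function on `Fin 16` (positions of `T`; plumbing). [cite: RhinViola2001, §5 (5.1), (4.7)] -/
private def Tfun (P : Params) : Fin 16 → ℤ :=
  ![P.h, P.j, P.k, P.l, P.m, P.q, P.r, P.s,
    P.aux.h, P.aux.j, P.aux.k, P.aux.l, P.aux.m, P.aux.q, P.aux.r, P.aux.s]

/-- `T` as `List.ofFn` (plumbing). [folklore] -/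
private theorem T_eq_ofFn (P : Params) : P.T = List.ofFn (Tfun P) := by
  simp [Params.T, Params.toList, Tfun, List.ofFn_succ]

/-- Reindexing a `List.ofFn` by a permutation of positions gives a permutation of the list (plumbing). [folklore] -/
private theorem perm_ofFn_comp (v : Fin 16 → ℤ) (π : Fin 16 → Fin 16)
    (hπ : (List.ofFn π).Perm (List.finRange 16)) : (List.ofFn (v ∘ π)).Perm (List.ofFn v) := by
  have h := hπ.map v
  rwa [List.map_ofFn, ← List.ofFn_eq_map] at h

/-- Positions of `T(ϑP)` in `T(P)` (plumbing). [folklore] -/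
private def permTheta : Fin 16 → Fin 16 := ![1, 2, 3, 4, 5, 6, 7, 0, 9, 10, 11, 12, 13, 14, 15, 8]
/-- Positions of `T(σP)` in `T(P)` (plumbing). [folklore] -/
private def permSigma : Fin 16 → Fin 16 := ![2, 1, 0, 7, 6, 5, 4, 3, 10, 9, 8, 15, 14, 13, 12, 11]
/-- Positions of `T(ϕP)` in `T(P)` (plumbing). [folklore] -/
private def permPhi : Fin 16 → Fin 16 := ![13, 1, 2, 14, 4, 6, 5, 7, 8, 9, 10, 11, 15, 0, 3, 12]
/-- Positions of `T(χP)` in `T(P)` (plumbing). [folklore] -/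
private def permChi : Fin 16 → Fin 16 := ![0, 13, 2, 3, 4, 9, 6, 7, 14, 5, 12, 11, 10, 1, 8, 15]

/-- "`ϕ`, `χ`, `ϑ` and `σ` can be viewed as permutations" of the sixteen integers (2.7)–(2.8): `T(gP)` is a permutation of
`T(P)`. [cite: RhinViola2001, §4 p. 281 and §2 p. 273] -/
theorem T_perm_theta (P : Params) : (theta P).T.Perm P.T := by
  have h : (theta P).T = List.ofFn (Tfun P ∘ permTheta) := by
    rw [Params.T, aux_theta]
    simp [Params.toList, Tfun, theta, permTheta, List.ofFn_succ]
  rw [h, T_eq_ofFn]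
  exact perm_ofFn_comp _ _ (by decide)

/-- "`ϕ`, `χ`, `ϑ` and `σ` can be viewed as permutations" of the sixteen integers (2.7)–(2.8): `T(gP)` is a permutation of
`T(P)`. [cite: RhinViola2001, §4 p. 281 and §2 p. 273] -/
theorem T_perm_sigma {P : Params} (hP : P.Balanced) : (sigma P).T.Perm P.T := by
  have h : (sigma P).T = List.ofFn (Tfun P ∘ permSigma) := by
    rw [Params.T, aux_sigma hP]
    simp [Params.toList, Tfun, sigma, permSigma, List.ofFn_succ]
  rw [h, T_eq_ofFn]
  exact perm_ofFn_comp _ _ (by decide)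

/-- "`ϕ`, `χ`, `ϑ` and `σ` can be viewed as permutations" of the sixteen integers (2.7)–(2.8): `T(gP)` is a permutation of
`T(P)`. [cite: RhinViola2001, §4 p. 281 and §2 p. 273] -/
theorem T_perm_phi {P : Params} (hP : P.Balanced) : (phi P).T.Perm P.T := by
  have h : (phi P).T = List.ofFn (Tfun P ∘ permPhi) := by
    rw [Params.T, aux_phi hP]
    simp [Params.toList, Tfun, phi, permPhi, List.ofFn_succ]
  rw [h, T_eq_ofFn]
  exact perm_ofFn_comp _ _ (by decide)

/-- "`ϕ`, `χ`, `ϑ` and `σ` can be viewed as permutations" of the sixteen integers (2.7)–(2.8): `T(gP)` is a permutation of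
`T(P)`. [cite: RhinViola2001, §4 p. 281 and §2 p. 273] -/
theorem T_perm_chi {P : Params} (hP : P.Balanced) : (chi P).T.Perm P.T := by
  have h : (chi P).T = List.ofFn (Tfun P ∘ permChi) := by
    rw [Params.T, aux_chi hP]
    simp [Params.toList, Tfun, chi, permChi, List.ofFn_succ]
  rw [h, T_eq_ofFn]
  exact perm_ofFn_comp _ _ (by decide)

/-- "`M`, `N` and `Q` [of (5.3)] are invariant under the actions" of the generators: the successive maxima of
the sixteen integers are `Φ`-invariant. [cite: RhinViola2001, §4 pp. 281–282, §5 (5.3)] -/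
theorem maxT_theta (P : Params) (i : ℕ) : maxT (theta P) i = maxT P i := succMax_eq_of_perm (T_perm_theta P) i

/-- The successive maxima (5.3) of the sixteen integers are invariant under this generator. [cite: RhinViola2001, §5 (5.3), (5.7)] -/
theorem maxT_sigma {P : Params} (hP : P.Balanced) (i : ℕ) : maxT (sigma P) i = maxT P i :=
  succMax_eq_of_perm (T_perm_sigma hP) i

/-- The successive maxima (5.3) of the sixteen integers are invariant under this generator. [cite: RhinViola2001, §5 (5.3), (5.7)] -/
theorem maxT_phi {P : Params} (hP : P.Balanced) (i : ℕ) : maxT (phi P) i = maxT P i :=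
  succMax_eq_of_perm (T_perm_phi hP) i

/-- The successive maxima (5.3) of the sixteen integers are invariant under this generator. [cite: RhinViola2001, §5 (5.3), (5.7)] -/
theorem maxT_chi {P : Params} (hP : P.Balanced) (i : ℕ) : maxT (chi P) i = maxT P i :=
  succMax_eq_of_perm (T_perm_chi hP) i

/-! ### The transformation formulae (4.1), (4.4) -/

/-- `h! j! k! l! m! q! r! s!` (for non-negative parameters). [cite: RhinViola2001, §4 (4.3)] -/
def factProd (P : Params) : ℕ :=
  Nat.factorial P.h.toNat * Nat.factorial P.j.toNat * Nat.factorial P.k.toNat * Nat.factorial P.l.toNat *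
    Nat.factorial P.m.toNat * Nat.factorial P.q.toNat * Nat.factorial P.r.toNat * Nat.factorial P.s.toNat

/-- The normalised integral (4.3): `I(h,j,k,l,m,q,r,s)/(h! j! k! l! m! q! r! s!)`. [cite: RhinViola2001, §4 (4.3)] -/
def normI (P : Params) : ℝ := I P / (factProd P : ℝ)

/-- **The hypergeometric transformation in `x`, (4.1)** (named fact; PROVED in the companion
`GroupStructureProofs.lean` as `hypergeometric_x_holds` — users' hypotheses `(h : hypergeometric_x)` are fed that
theorem): for parameters with
(2.2)–(2.3) and all sixteen integers (2.7)–(2.8) non-negative,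
`I(h,j,k,l,m,q,r,s) = h! l!/(q'! r'!) · I(q', j, k, r', m, r, q, s)`, `q' = q+h−r`, `r' = r+l−q` (Euler's integral
for `₂F₁` and its symmetry in the two numerator parameters). [cite: RhinViola2001, §4 (4.1), p. 280] -/
def hypergeometric_x : Prop :=
  ∀ P : Params, P.Admissible →
    I P = ((Nat.factorial P.h.toNat * Nat.factorial P.l.toNat : ℕ) : ℝ) /
        ((Nat.factorial P.aux.q.toNat * Nat.factorial P.aux.r.toNat : ℕ) : ℝ) * I (phi P)

/-- **The hypergeometric transformation in `z`** (named fact; PROVED in the companion `GroupStructureProofs.lean`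
as `hypergeometric_z_holds`): under the same assumptions,
`I(h,j,k,l,m,q,r,s) = j! q!/(q'! j'!) · I(h, q', k, l, m, j', r, s)`, `q' = q+h−r`, `j' = j+r−h`.
[cite: RhinViola2001, §4 p. 281 (display before "Let χ denote this hypergeometric transformation")] -/
def hypergeometric_z : Prop :=
  ∀ P : Params, P.Admissible →
    I P = ((Nat.factorial P.j.toNat * Nat.factorial P.q.toNat : ℕ) : ℝ) /
        ((Nat.factorial P.aux.q.toNat * Nat.factorial P.aux.j.toNat : ℕ) : ℝ) * I (chi P)

/-- The four generators `ϕ, χ, ϑ, σ` of `Φ`. [cite: RhinViola2001, §4 p. 281 (`Φ = ⟨ϕ, χ, ϑ, σ⟩`)] -/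
inductive Gen
  | Phi
  | Chi
  | Theta
  | Sigma
deriving DecidableEq

/-- The action of a generator on the parameters. [cite: RhinViola2001, §4 (4.4)] -/
def Gen.act : Gen → Params → Params
  | .Phi => phi
  | .Chi => chi
  | .Theta => theta
  | .Sigma => sigma

/-- The action of a word `ϱ` in the generators (applied right to left): `(ϱ(h), …, ϱ(s))`. [cite: RhinViola2001, §4 (4.4)] -/
def act (w : List Gen) (P : Params) : Params := w.foldr (fun g Q => g.act Q) P

/-- The generators preserve admissibility: "Note that `ϱ(h)+ϱ(m) = ϱ(k)+ϱ(r)` and `ϱ(j)+ϱ(q) = ϱ(l)+ϱ(s)`, since this property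
holds for the generators of the group `Φ`", and they permute the sixteen non-negative integers. [cite: RhinViola2001, §4 p. 284] -/
theorem admissible_act_gen (g : Gen) {P : Params} (hP : P.Admissible) : (g.act P).Admissible := by
  obtain ⟨⟨h1, h2⟩, hN, hA⟩ := hP
  obtain ⟨_, _, _, _, _, _, _, _⟩ := hN
  obtain ⟨_, _, _, _, _, _, _, _⟩ := hA
  cases g <;>
    simp only [Gen.act, Params.Admissible, Params.Balanced, Params.Nonneg, Params.aux, phi, chi, theta,
      sigma] at * <;> omega

/-- Every word in the generators preserves admissibility ("Therefore, Theorem 2.1 is applicable to the integral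
`I(ϱ(h), ϱ(j), ϱ(k), ϱ(l), ϱ(m), ϱ(q), ϱ(r), ϱ(s))`"). [cite: RhinViola2001, §4 p. 284] -/
theorem admissible_act (w : List Gen) {P : Params} (hP : P.Admissible) : (act w P).Admissible := by
  induction w with
  | nil => exact hP
  | cons g w ih => exact admissible_act_gen g ih

/-- One generator: `I(P)/∏P! = I(gP)/∏(gP)!`, from (4.1), its `z`-analogue and the `Θ`-invariance. [cite: RhinViola2001, §4 (4.4)] -/
theorem normI_act_gen (hx : hypergeometric_x) (hz : hypergeometric_z) (hθ : invariance_theta) (g : Gen)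
    {P : Params} (hP : P.Admissible) : normI (g.act P) = normI P := by
  have hfact : ∀ n : ℕ, (Nat.factorial n : ℝ) ≠ 0 := fun n => by positivity
  cases g with
  | Phi =>
    simp only [Gen.act, normI]
    rw [hx P hP]
    simp only [factProd, phi]
    push_cast
    field_simp
  | Chi =>
    simp only [Gen.act, normI]
    rw [hz P hP]
    simp only [factProd, chi]
    push_cast
    field_simp
  | Theta =>
    simp only [Gen.act, normI]
    rw [hθ P hP.2.1 hP.1]
    simp only [factProd, theta]
    push_cast
    ring
  | Sigma =>
    simp only [Gen.act, normI]
    rw [invariance_sigma hP.1]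
    simp only [factProd, sigma]
    push_cast
    ring

/-- **The transformation formula (4.4)** (PROVED from the generator statements): for every word `ϱ` in
`ϕ, χ, ϑ, σ` and admissible parameters, `I(h,…,s)/(h!⋯s!) = I(ϱ(h),…,ϱ(s))/(ϱ(h)!⋯ϱ(s)!)` — "the value of (4.3)
is invariant under the action of the permutation group `Φ`". [cite: RhinViola2001, §4 (4.4), p. 284] -/
theorem normI_act (hx : hypergeometric_x) (hz : hypergeometric_z) (hθ : invariance_theta) (w : List Gen)
    {P : Params} (hP : P.Admissible) : normI (act w P) = normI P := by
  induction w with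
  | nil => rfl
  | cons g w ih =>
    show normI (g.act (act w P)) = normI P
    rw [normI_act_gen hx hz hθ g (admissible_act w hP), ih]

/-- The level-4 representative `ϕϑ²ϕ` of (5.4): `(h,j,k,l,m,q,r,s) ↦ (m', r', m, h', q, q', s, j)`.
[cite: RhinViola2001, §5 (5.4)] -/
theorem phi_theta_theta_phi {P : Params} (hP : P.Balanced) :
    phi (theta (theta (phi P))) = ⟨P.aux.m, P.aux.r, P.m, P.aux.h, P.q, P.aux.q, P.s, P.j⟩ := by
  obtain ⟨h1, h2⟩ := hP
  ext <;> simp only [phi, theta, Params.aux] <;> omega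

/-- The level-8 coset representative `η = ϕϑ²ϕϑ⁴ϕϑ²ϕ = (h k')(j s')(k m')(l j')(m r')(q l')(r h')(s q')`.
[cite: RhinViola2001, §4 p. 286] -/
theorem eta_apply {P : Params} (hP : P.Balanced) :
    act [.Phi, .Theta, .Theta, .Phi, .Theta, .Theta, .Theta, .Theta, .Phi, .Theta, .Theta, .Phi] P =
      ⟨P.aux.k, P.aux.s, P.aux.m, P.aux.j, P.aux.r, P.aux.l, P.aux.h, P.aux.q⟩ := by
  obtain ⟨h1, h2⟩ := hP
  ext <;> simp only [act, List.foldr, Gen.act, phi, theta, Params.aux] <;> omega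

/-! ### §5: the data of the record computation -/

/-- Rhin–Viola's choice `h = 16, j = 17, k = 19, l = 15, m = 12, q = 11, r = 9, s = 13`.
[cite: RhinViola2001, §5 p. 292] -/
def rvChoice : Params := ⟨16, 17, 19, 15, 12, 11, 9, 13⟩

/-- "`h' = 14, j' = 10, k' = 15, l' = 12, m' = 14, q' = 18, r' = 13, s' = 16`". [cite: RhinViola2001, §5 p. 292] -/
theorem rvChoice_aux : rvChoice.aux = ⟨14, 10, 15, 12, 14, 18, 13, 16⟩ := by decide

/-- The choice satisfies `h + m = k + r`, `j + q = l + s` with all sixteen integers positive. [cite: RhinViola2001, §5 p. 292] -/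
theorem rvChoice_admissible : rvChoice.Admissible := by
  unfold Params.Admissible Params.Balanced Params.Nonneg; decide

/-- "and, by (5.3), `M = 19`, `N = 18`, `Q = 17`." [cite: RhinViola2001, §5 p. 292] -/
theorem rvChoice_maxT : maxT rvChoice 0 = 19 ∧ maxT rvChoice 1 = 18 ∧ maxT rvChoice 2 = 17 := by decide

/-- The maxima of Theorem 2.1 for the same parameters (over the eight integers (2.8) only): `18, 16, 15` (our evaluation of
the printed data). [cite: RhinViola2001, Theorem 2.1 and §5 p. 292] -/
theorem rvChoice_succMaxS :
    succMax rvChoice.S 0 = 18 ∧ succMax rvChoice.S 1 = 16 ∧ succMax rvChoice.S 2 = 15 := by decide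

/-- The printed constants of the record computation: `c₀ = 47.15472079…`, `c₁ = 48.46940964…`,
`c₂ = 29.81231469…`, and `(c₀ + c₁)/(c₀ − c₂) < 5.513891` (Theorem 5.1 ⇒ (1.4)); checked here on the printed
decimals. [cite: RhinViola2001, §5 p. 293, Theorem 5.1] -/
theorem record_quotient_lt :
    ((47.15472079 : ℝ) + 48.46940964) / (47.15472079 - 29.81231469) < 5.513891 := by norm_num

end Literature.NumberTheory.Irrationality.RhinViola2001

end
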